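import Summits.SmoothPoincare4.SmoothPoincare4.Theses.SblfDescent
import Literature.Topology.FourManifolds.SimplifiedBrokenLefschetzFibration

/-!
# SmoothPoincare4 / SblfDescent — crux `StepGE3`, line `cusp-free-thinning` (strategist, alternative line)

Crux item stmt-SmoothPoincare4-18528, route decl
`Summit.SmoothPoincare4.SmoothPoincare4.Theses.SblfDescent.StepGE3`:
for every smooth `M ≃ₕ S⁴` and every `h ≥ 1`, an SBLF of lower genus `h + 1` on `M` (genus `h + 2`,
`4h + 4` positive Lefschetz points on the higher side) yields one of lower genus `h`.

## The line (push-down strata in MAP language; the waist is "where cusps become necessary")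

Un-flip-and-slip descent factors through ONE intermediate object that is a statement about
maps, not about mapping class groups:

* a **split broken Lefschetz fibration** (`IsSplitBrokenLefschetzFibration o g Lhi Llo n`): the
  tree's SBLF structure with the Lefschetz set split into `Lhi` (on the higher, genus-`n + 1`
  side) and `Llo` (on the LOWER, genus-`n` side) — Hayano 2011 Def. 2.1 allows Lefschetz points on
  either side; "simplified" (Def. 2.3 / Baykur–Kamada §3) is the case `Llo = ∅`;
* a **cusp-free deformation** (`CuspFreeDeformation o f g`): a smooth one-parameter family of
  fold–Lefschetz maps (`IsFoldLefschetzMap`: every critical point is a positive Lefschetz point or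
  an indefinite fold point; NO cusps, births, merges, wrinkles; injectivity on the critical set is
  NOT required at intermediate times) from `f` to `g`.  Such families realise exactly: isotopies,
  Hurwitz moves, R₂-moves of the fold image (Hayano arXiv:1203.4299 §3, Thm 3.9) and the pushing
  of a Lefschetz critical value across the fold (down iff its vanishing cycle is disjoint from the
  fold cycle `c`, Baykur–Hayano arXiv:1410.5531 §4.3; up always, Baykur arXiv:1205.5439 Lemma 1).

A flip-and-slip stabilisation of a genus-`(h+1)` SBLF, followed by pushing the old Lefschetz
points up (Baykur 2012, proof of Lemma 12; Hayano 2014 Thm 4.1), is a genus-`(h+2)` SBLF whose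
system has `4h` cycles DISJOINT from `c` and `4` cycles meeting `c`; pushing the `4h` back down is
cusp-free and leaves a split BLF with `Lhi.card = 4`.  The line asserts the converse structure:

* `stub_cuspFreeThinning` (the HEART, unshielded on `S⁴` itself): every SBLF of lower genus
  `h + 1 ≥ 2` on a homotopy 4-sphere deforms WITHOUT CUSPS to a split BLF of the same genera with
  at most four Lefschetz points left on the higher side ("pushability corank `m(f) ≤ 4`",
  card push-down-strata S-corank, minimised over the cusp-free deformation class, which is
  coarser than the Hurwitz class: Baykur–Hayano Thm 4.8's infinite family collapses after one
  push);
* `stub_unflipThinBlock` (geography + a bounded mapping-class classification + Hayano's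
  algorithm run backwards; cusps ARE used inside its proof — sink ×4, un-slip, un-flip ×2): a
  homotopy 4-sphere carrying a split BLF of lower genus `h + 1`, `h ≥ 1`, with at most four
  Lefschetz points on the higher side admits an SBLF of lower genus `h`.  At `h = 1` the inert
  top blocks are excluded by Baykur–Korkmaz (no genus-2 Lefschetz fibration over `S²` with fewer
  than 7 singular fibres, arXiv:1510.00089) and blocks of length `≤ 1` by `π₁(M) = 1`
  (all-disjoint ⇒ `π₁(M) ↠ ℤ`) and `i(t_a(c), c) = i(a, c)²`.

`StepGE3_of` is the sorry-free composition concluding the route decl BY NAME.  The three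
predicates are line vocabulary (D-0016 `<Route>Defs` pattern): a lead adopting the line lands
them verbatim as `Theorems/SblfDescentStepGE3ThinningDefs.lean` (namespace
`Summit.SmoothPoincare4.SmoothPoincare4.Theorems`, so the registered stub signatures restate
verbatim) before filing `--supports` proofs.

Sanity (proved below, sorry-free): an SBLF is a split BLF with `Llo = ∅`
(`isSplit_of_isSimplified`), and the cusp-free deformation relation is reflexive on fold–Lefschetz
maps (`cuspFreeDeformation_refl`) — the product-manifold smoothness clause elaborates and is
inhabited.
-/

set_option linter.dupNamespace false

noncomputable section

namespace Summit.SmoothPoincare4.SmoothPoincare4.Theorems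

open scoped Manifold ContDiff Topology ContinuousMap
open Literature.Topology.FourManifolds

universe u

/-! ## Line vocabulary -/

/-- **Fold–Lefschetz map** (the pointwise part of Hayano 2011, Def. 2.1, with positive Lefschetz
points only): `f : X → S²` is smooth, every point of the finite set `L` is a positive Lefschetz
critical point (`IsLefschetzCriticalPoint … true`), and every other critical point is an
indefinite fold point, `(t, x₁, x₂, x₃) ↦ (t, x₁² + x₂² − x₃²)` in smooth charts.  No cusps; no
global condition (injectivity on the critical set, connectedness of fibres or of the round locus)
is imposed — these are the maps met at every instant of a cusp-free deformation.
[cite: Hayano2011, Def. 2.1] -/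
structure IsFoldLefschetzMap {X : Type u} [TopologicalSpace X]
    [ChartedSpace (EuclideanSpace ℝ (Fin 4)) X] [IsManifold (𝓡 4) 1 X]
    (o : SmoothOrientation (𝓡 4) X) (f : X → Metric.sphere (0 : EuclideanSpace ℝ (Fin 3)) 1)
    (L : Finset X) : Prop where
  /-- `f` is smooth -/
  contMDiff : ContMDiff (𝓡 4) (𝓡 2) ∞ f
  /-- every point of `L` is a positive Lefschetz critical point -/
  lefschetz : ∀ p ∈ L, IsLefschetzCriticalPoint (𝓡 4) (𝓡 2) o f p true
  /-- every critical point off `L` is an indefinite fold point -/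
  fold : ∀ p : X, ¬ Function.Surjective (mfderiv (𝓡 4) (𝓡 2) f p) → p ∉ L →
    ∃ (φ : OpenPartialHomeomorph X (EuclideanSpace ℝ (Fin 4)))
      (ψ : OpenPartialHomeomorph (Metric.sphere (0 : EuclideanSpace ℝ (Fin 3)) 1)
        (EuclideanSpace ℝ (Fin 2))),
      p ∈ φ.source ∧ φ p = 0 ∧ Set.MapsTo f φ.source ψ.source ∧
      ContMDiffOn (𝓡 4) (𝓡 4) ∞ φ φ.source ∧ ContMDiffOn (𝓡 4) (𝓡 4) ∞ φ.symm φ.target ∧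
      ContMDiffOn (𝓡 2) (𝓡 2) ∞ ψ ψ.source ∧ ContMDiffOn (𝓡 2) (𝓡 2) ∞ ψ.symm ψ.target ∧
      ∀ q ∈ φ.source, (ψ (f q)) 0 = (φ q) 0 ∧
        (ψ (f q)) 1 = (φ q) 1 ^ 2 + (φ q) 2 ^ 2 - (φ q) 3 ^ 2

/-- **Split broken Lefschetz fibration of lower genus `h`** (Hayano 2011, Def. 2.1 with the
fibre-connectedness / embedded-round-image clauses of Def. 2.3, but Lefschetz points allowed on
BOTH sides): all clauses of the tree's `IsSimplifiedBrokenLefschetzFibration o f (Lhi ∪ Llo) h`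
(written without `Finset` unions, so no decidability instance enters the statement) except "Lefschetz points on the higher side", which is replaced by: the points of `Lhi` have
nearby regular fibres of genus `h + 1` (higher side), the points of `Llo` have nearby regular
fibres of genus `h` (lower side); `Lhi` and `Llo` are disjoint.  `Llo = ∅` is the simplified case
(`isSplit_of_isSimplified`). [cite: Hayano2011, Def. 2.1 and Def. 2.3] -/
structure IsSplitBrokenLefschetzFibration {X : Type u} [TopologicalSpace X]
    [ChartedSpace (EuclideanSpace ℝ (Fin 4)) X] [IsManifold (𝓡 4) 1 X]
    (o : SmoothOrientation (𝓡 4) X) (f : X → Metric.sphere (0 : EuclideanSpace ℝ (Fin 3)) 1)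
    (Lhi Llo : Finset X) (h : ℕ) : Prop where
  /-- `f` is smooth -/
  contMDiff : ContMDiff (𝓡 4) (𝓡 2) ∞ f
  /-- `f` is onto -/
  surjective : Function.Surjective f
  /-- the two Lefschetz sets are disjoint -/
  disjoint : Disjoint Lhi Llo
  /-- every point of `Lhi` and of `Llo` is a positive Lefschetz critical point -/
  lefschetz : ∀ p : X, p ∈ Lhi ∨ p ∈ Llo → IsLefschetzCriticalPoint (𝓡 4) (𝓡 2) o f p true
  /-- every critical point off `Lhi` and `Llo` is an indefinite fold point -/
  fold : ∀ p : X, ¬ Function.Surjective (mfderiv (𝓡 4) (𝓡 2) f p) → p ∉ Lhi → p ∉ Llo →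
    ∃ (φ : OpenPartialHomeomorph X (EuclideanSpace ℝ (Fin 4)))
      (ψ : OpenPartialHomeomorph (Metric.sphere (0 : EuclideanSpace ℝ (Fin 3)) 1)
        (EuclideanSpace ℝ (Fin 2))),
      p ∈ φ.source ∧ φ p = 0 ∧ Set.MapsTo f φ.source ψ.source ∧
      ContMDiffOn (𝓡 4) (𝓡 4) ∞ φ φ.source ∧ ContMDiffOn (𝓡 4) (𝓡 4) ∞ φ.symm φ.target ∧
      ContMDiffOn (𝓡 2) (𝓡 2) ∞ ψ ψ.source ∧ ContMDiffOn (𝓡 2) (𝓡 2) ∞ ψ.symm ψ.target ∧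
      ∀ q ∈ φ.source, (ψ (f q)) 0 = (φ q) 0 ∧
        (ψ (f q)) 1 = (φ q) 1 ^ 2 + (φ q) 2 ^ 2 - (φ q) 3 ^ 2
  /-- the round locus (critical points off `Lhi` and `Llo`) is connected and non-empty -/
  isConnected_round :
    IsConnected ({p : X | ¬ Function.Surjective (mfderiv (𝓡 4) (𝓡 2) f p)} \
      ((↑Lhi : Set X) ∪ (↑Llo : Set X)))
  /-- `f` is injective on the critical set -/
  injOn_crit : Set.InjOn f {p : X | ¬ Function.Surjective (mfderiv (𝓡 4) (𝓡 2) f p)}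
  /-- regular fibres are connected, of genus `h + 1` or `h` -/
  fibre : ∀ y, (∀ q, f q = y → Function.Surjective (mfderiv (𝓡 4) (𝓡 2) f q)) →
    IsConnected (f ⁻¹' {y}) ∧
      (Nonempty ((Fin (2 * (h + 1)) → ℤ) ≃ₗ[ℤ]
          Literature.AlgebraicTopology.SingularHomology.singularHomology ℤ ℤ ↥(f ⁻¹' {y}) 1) ∨
        Nonempty ((Fin (2 * h) → ℤ) ≃ₗ[ℤ]
          Literature.AlgebraicTopology.SingularHomology.singularHomology ℤ ℤ ↥(f ⁻¹' {y}) 1))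
  /-- some regular fibre has genus `h + 1` (the higher side) -/
  exists_higher : ∃ y, (∀ q, f q = y → Function.Surjective (mfderiv (𝓡 4) (𝓡 2) f q)) ∧
    Nonempty ((Fin (2 * (h + 1)) → ℤ) ≃ₗ[ℤ]
      Literature.AlgebraicTopology.SingularHomology.singularHomology ℤ ℤ ↥(f ⁻¹' {y}) 1)
  /-- some regular fibre has genus `h` (the lower side) -/
  exists_lower : ∃ y, (∀ q, f q = y → Function.Surjective (mfderiv (𝓡 4) (𝓡 2) f q)) ∧
    Nonempty ((Fin (2 * h) → ℤ) ≃ₗ[ℤ]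
      Literature.AlgebraicTopology.SingularHomology.singularHomology ℤ ℤ ↥(f ⁻¹' {y}) 1)
  /-- the points of `Lhi` lie on the higher side -/
  lefschetz_higher : ∀ p ∈ Lhi, ∀ᶠ y in 𝓝 (f p),
    (∀ q, f q = y → Function.Surjective (mfderiv (𝓡 4) (𝓡 2) f q)) →
      Nonempty ((Fin (2 * (h + 1)) → ℤ) ≃ₗ[ℤ]
        Literature.AlgebraicTopology.SingularHomology.singularHomology ℤ ℤ ↥(f ⁻¹' {y}) 1)
  /-- the points of `Llo` lie on the LOWER side -/
  lefschetz_lower : ∀ p ∈ Llo, ∀ᶠ y in 𝓝 (f p),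
    (∀ q, f q = y → Function.Surjective (mfderiv (𝓡 4) (𝓡 2) f q)) →
      Nonempty ((Fin (2 * h) → ℤ) ≃ₗ[ℤ]
        Literature.AlgebraicTopology.SingularHomology.singularHomology ℤ ℤ ↥(f ⁻¹' {y}) 1)

/-- **Cusp-free deformation** from `f` to `g`: a smooth map `F : X × ℝ → S²` with `F(·, 0) = f`,
`F(·, 1) = g`, such that for every `t ∈ [0, 1]` the map `F(·, t)` is a fold–Lefschetz map for
some finite positive Lefschetz set.  (Smoothness on all of `X × ℝ` is asked for convenience; a
family on `[0, 1]` is made constant outside by a smooth reparametrisation.)  These are the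
deformations of Hayano's `R₂`-move paper (arXiv:1203.4299, §3: homotopies through broken
Lefschetz fibrations in which singular values may cross) without its cusped members.
[cite: Hayano2012, §3] -/
def CuspFreeDeformation {X : Type u} [TopologicalSpace X]
    [ChartedSpace (EuclideanSpace ℝ (Fin 4)) X] [IsManifold (𝓡 4) 1 X]
    (o : SmoothOrientation (𝓡 4) X)
    (f g : X → Metric.sphere (0 : EuclideanSpace ℝ (Fin 3)) 1) : Prop :=
  ∃ F : X × ℝ → Metric.sphere (0 : EuclideanSpace ℝ (Fin 3)) 1,
    ContMDiff ((𝓡 4).prod 𝓘(ℝ, ℝ)) (𝓡 2) ∞ F ∧ (∀ x, F (x, 0) = f x) ∧ (∀ x, F (x, 1) = g x) ∧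
      ∀ t ∈ Set.Icc (0 : ℝ) 1, ∃ Lt : Finset X, IsFoldLefschetzMap o (fun x => F (x, t)) Lt

/-! ## Sanity lemmas (sorry-free) -/

section Sanity

variable {X : Type u} [TopologicalSpace X] [ChartedSpace (EuclideanSpace ℝ (Fin 4)) X]
  [IsManifold (𝓡 4) 1 X] {o : SmoothOrientation (𝓡 4) X}
  {f : X → Metric.sphere (0 : EuclideanSpace ℝ (Fin 3)) 1} {L : Finset X} {h : ℕ}

/-- An SBLF is a fold–Lefschetz map. -/
theorem isFoldLefschetzMap_of_isSimplified (hf : IsSimplifiedBrokenLefschetzFibration o f L h) :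
    IsFoldLefschetzMap o f L :=
  ⟨hf.contMDiff, hf.lefschetz, hf.fold⟩

/-- An SBLF of lower genus `h` is a split BLF of lower genus `h` with empty lower Lefschetz set. -/
theorem isSplit_of_isSimplified (hf : IsSimplifiedBrokenLefschetzFibration o f L h) :
    IsSplitBrokenLefschetzFibration o f L ∅ h where
  contMDiff := hf.contMDiff
  surjective := hf.surjective
  disjoint := Finset.disjoint_empty_right L
  lefschetz := fun p hp => hf.lefschetz p (by simpa using hp)
  fold := fun p hp hpL _ => hf.fold p hp hpL
  isConnected_round := by simpa using hf.isConnected_round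
  injOn_crit := hf.injOn_crit
  fibre := hf.fibre
  exists_higher := hf.exists_higher
  exists_lower := hf.exists_lower
  lefschetz_higher := hf.lefschetz_higher
  lefschetz_lower := by simp

/-- The cusp-free deformation relation is reflexive on fold–Lefschetz maps (constant family). -/
theorem cuspFreeDeformation_refl (hf : IsFoldLefschetzMap o f L) : CuspFreeDeformation o f f := by
  refine ⟨fun p => f p.1, hf.contMDiff.comp contMDiff_fst, fun _ => rfl, fun _ => rfl, ?_⟩
  intro t _
  exact ⟨L, hf⟩

end Sanity

/-! ## The two registered stubs -/

/-- **Stub (line cusp-free-thinning, the HEART): cusp-free thinning to pushability corank ≤ 4.**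
For a smooth homotopy 4-sphere `M`, `h ≥ 1`, and an SBLF `f : M → S²` of lower genus `h + 1`
(genus `h + 2`), there is a cusp-free deformation of `f` (isotopies, Hurwitz moves, R₂-moves,
pushing Lefschetz values across the fold) to a split broken Lefschetz fibration `g` of the same
genera with AT MOST FOUR Lefschetz points on the higher side.  Content-ful already on `S⁴`
(refutable by one genus-`≥ 3` SBLF of `S⁴` whose cusp-free class is not thin); true for
flip-and-slip stabilisations by Hayano 2014 Thm 4.1 + Baykur 2012 Lemma 1.  Card
push-down-strata: S-corank. -/
theorem stub_cuspFreeThinning :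
    ∀ (M : Type) [TopologicalSpace M] [T2Space M] [SecondCountableTopology M]
      [ChartedSpace (EuclideanSpace ℝ (Fin 4)) M]
      [IsManifold (𝓡 4) ((⊤ : ℕ∞) : WithTop ℕ∞) M],
      M ≃ₕ Metric.sphere (0 : EuclideanSpace ℝ (Fin 5)) 1 → ∀ h : ℕ, 1 ≤ h →
      ∀ (o : Literature.Topology.FourManifolds.SmoothOrientation (𝓡 4) M)
        (f : M → Metric.sphere (0 : EuclideanSpace ℝ (Fin 3)) 1) (L : Finset M),
        Literature.Topology.FourManifolds.IsSimplifiedBrokenLefschetzFibration o f L (h + 1) →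
        ∃ (g : M → Metric.sphere (0 : EuclideanSpace ℝ (Fin 3)) 1) (Lhi Llo : Finset M),
          CuspFreeDeformation o f g ∧ IsSplitBrokenLefschetzFibration o g Lhi Llo (h + 1) ∧
            Lhi.card ≤ 4 := by
  sorry

/-- **Stub (line cusp-free-thinning): un-flipping a thin top block.**  For a smooth homotopy
4-sphere `M`, `h ≥ 1`, and a split broken Lefschetz fibration `g : M → S²` of lower genus `h + 1`
with at most four Lefschetz points on the higher side (the rest on the lower side), `M` admits an
SBLF of lower genus `h`.  Internal plan (card push-down-strata): top blocks of length `≤ 1` are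
impossible on a simply connected `M`; an INERT top block (capped monodromy trivial) closes the
lower side up into an honest genus-`(h+1)` Lefschetz fibration over `S²` with `4h + 4 − m`
singular fibres and `χ = 4 − m`, excluded by Lefschetz geography (at `h = 1`: Baykur–Korkmaz,
`< 7` singular fibres at genus 2 is impossible); an ACTIVE top block of length `≤ 4` is
Hurwitz-equivalent to Hayano's flip-and-slip block (bounded classification), which un-flips
(sink ×4, un-slip, un-flip ×2; Hayano 2014 Thm 4.1 backwards) to an SBLF of genus `h + 1`. -/
theorem stub_unflipThinBlock :
    ∀ (M : Type) [TopologicalSpace M] [T2Space M] [SecondCountableTopology M]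
      [ChartedSpace (EuclideanSpace ℝ (Fin 4)) M]
      [IsManifold (𝓡 4) ((⊤ : ℕ∞) : WithTop ℕ∞) M],
      M ≃ₕ Metric.sphere (0 : EuclideanSpace ℝ (Fin 5)) 1 → ∀ h : ℕ, 1 ≤ h →
      ∀ (o : Literature.Topology.FourManifolds.SmoothOrientation (𝓡 4) M)
        (g : M → Metric.sphere (0 : EuclideanSpace ℝ (Fin 3)) 1) (Lhi Llo : Finset M),
        IsSplitBrokenLefschetzFibration o g Lhi Llo (h + 1) → Lhi.card ≤ 4 →
        ∃ (o' : Literature.Topology.FourManifolds.SmoothOrientation (𝓡 4) M)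
          (f' : M → Metric.sphere (0 : EuclideanSpace ℝ (Fin 3)) 1) (L' : Finset M),
          Literature.Topology.FourManifolds.IsSimplifiedBrokenLefschetzFibration o' f' L' h := by
  sorry

/-! ## Composition -/

/-- The crux in tree vocabulary from the two stubs: thin without cusps, then un-flip. -/
theorem hasSblf_descend_of_thin_unflip
    (M : Type) [TopologicalSpace M] [T2Space M] [SecondCountableTopology M]
    [ChartedSpace (EuclideanSpace ℝ (Fin 4)) M] [IsManifold (𝓡 4) ((⊤ : ℕ∞) : WithTop ℕ∞) M]
    (e : M ≃ₕ Metric.sphere (0 : EuclideanSpace ℝ (Fin 5)) 1) (h : ℕ) (hh : 1 ≤ h)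
    (o : SmoothOrientation (𝓡 4) M) (f : M → Metric.sphere (0 : EuclideanSpace ℝ (Fin 3)) 1)
    (L : Finset M) (hf : IsSimplifiedBrokenLefschetzFibration o f L (h + 1)) :
    ∃ (o' : SmoothOrientation (𝓡 4) M) (f' : M → Metric.sphere (0 : EuclideanSpace ℝ (Fin 3)) 1)
      (L' : Finset M), IsSimplifiedBrokenLefschetzFibration o' f' L' h := by
  obtain ⟨g, Lhi, Llo, -, hg, hcard⟩ := stub_cuspFreeThinning M e h hh o f L hf
  exact stub_unflipThinBlock M e h hh o g Lhi Llo hg hcard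

/-- **Composition (line cusp-free-thinning): `StepGE3`.**  Unpack the route's inline
`HAS(M, h + 1)` into `IsSimplifiedBrokenLefschetzFibration o f L (h + 1)` (the clauses are the
fields, in order), descend by `hasSblf_descend_of_thin_unflip`, repack into the inline
`HAS(M, h)`.  Sorry-free apart from the two stubs; concludes the crux BY NAME. -/
theorem StepGE3_of : Summit.SmoothPoincare4.SmoothPoincare4.Theses.SblfDescent.StepGE3 := by
  intro M _ _ _ _ _ e h hh hM
  obtain ⟨o, f, L, h1, h2, h3, h4, h5, h6, h7, h8, h9, h10⟩ := hM
  have hS : IsSimplifiedBrokenLefschetzFibration o f L (h + 1) :=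
    ⟨h1, h2, h3, h4, h5, h6, h7, h8, h9, h10⟩
  obtain ⟨o', f', L', g1, g2, g3, g4, g5, g6, g7, g8, g9, g10⟩ :=
    hasSblf_descend_of_thin_unflip M e h hh o f L hS
  exact ⟨o', f', L', g1, g2, g3, g4, g5, g6, g7, g8, g9, g10⟩

end Summit.SmoothPoincare4.SmoothPoincare4.Theorems

end
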